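import Summits.Parity.GeneralizedHardyLittlewood.Theorems.BeyondDiagonalBeatsQuarter.OffDiagLevelCharSplit
import Mathlib.Algebra.Order.Chebyshev
import Mathlib.NumberTheory.DirichletCharacter.Bounds
import HarnessLib

/-!
# Route `PrimeLevelFamEdge`, crux K_B (stmt-Parity-20343), line `diagonal_kernel_split` rev 4, plan Ω, sub-line Ω-f
# (OMEGA-BLUEPRINT v4 §3c, L7 re-homed on the large sieve) — **the large-sieve bound for the large-conductor parts
# `levelLargePart R` over all moduli `h ≤ H`, in the weighted Cauchy–Schwarz forms the assembly (L7d) consumes**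
# (the «L7-bridge», part 2 of 2; part 1 = `OffDiagLevelCharSplit`)

One modulus (tools for the assembly): `levelLargePart_add/_const_mul/_fun_sum` (linearity in the level weight — separated
weights `F(q) = Σ_j g_j b_j(q)` from L7c are consumed term by term) and the trivial bounds `norm_levelLargePart_le`,
`norm_levelSmallPart_le` (`≤ Σ_{q∈Q} ‖F q‖`, the «trivial mass» of one term). For levels `Q ⊆ (M₀, M₀+N]` coprime to every
modulus `1 ≤ h ≤ H` (e.g. primes `> H`) and `1 ≤ R`:

* **`sum_moduli_totient_inv_sum_largeConductor_le`** — E18 (`LargeSieve.sum_totient_inv_largeConductor_le'`, p646696) in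
  `Q`-form: `Σ_{h ≤ H} φ(h)⁻¹ Σ_{cond χ > R} ‖Σ_{q∈Q} F q χ q‖² ≤ (1 + log H)²·(2(N+1)/R + 4H)·Σ_{q∈Q} ‖F q‖²`;
* **`sum_moduli_sum_coprime_norm_sq_levelLargePart_le`** — with Parseval (part 1): the mean square over all moduli and
  reduced classes `Σ_{h ≤ H} Σ_{c < h, (c,h)=1} ‖levelLargePart R Q F h c‖²` has the same bound;
* **`norm_sum_moduli_sum_coprime_mul_levelLargePart_le`** — the weighted Cauchy–Schwarz form (the shape a dispersion-free
  user needs): `‖Σ_{h ≤ H} Σ_c W(h,c)·levelLargePart R Q F h c‖ ≤ ‖W‖₂·(1 + log H)·(2(N+1)/R + 4H)^{1/2}·‖F‖₂`;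
* `sum_norm_sq_sum_fiber_le` (fibre Cauchy–Schwarz; the flat one is Mathlib's `Real.sum_mul_le_sqrt_mul_sqrt`) and the INDEX form **`norm_sum_mul_levelLargePart_le_of_multiplicity`**:
  for a finite family `i ∈ I` of (modulus, class) pairs `(md i, cl i)` with weights `w i` and a multiplicity bound
  `#{i : (md i, cl i) = (h,c)} ≤ m(h)` (the FLATNESS count, L7b),
  `‖Σ_i w_i·levelLargePart R Q F (md i) (cl i)‖ ≤ (Σ_i m(md i)‖w_i‖²)^{1/2}·(1 + log H)(2(N+1)/R + 4H)^{1/2}‖F‖₂`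
  (`_zmod`: classes as units of `ZMod (md i)`, multiplicity on `.val`);
* `_of_subset_primes` corollaries for `Q ⊆` the primes of `(N₀, 2N₀]` (e.g. `goodPrimes Δ′ N₀`), `H ≤ N₀` (coprimality automatic).

What L7d still has to supply (not here): the `h`-independence of the level weight `F` (L7c, separation of the
`q`-dependence of `Φ̂_q`), the flatness count `m(h) ≍ M²/h + M` for the classes `−lm(cs)⁻¹/(d₁d₂)` (L7b), and the
ms-currency comparison with `dualLedgerTotal_scales_le` (saving `(N^{1−δ}/π(N))^{1/2}·polylog` at `R = N^δ`, `H` the dual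
modulus range). Pure inequalities for finite sums; standard axioms. Helper toward `stub_offDiagBelowSlack_io`; closes nothing.
«The programme SEARCHES and TYPES; no claim about Landau–Siegel zeros, Theorems 1–2 of arXiv:2211.02515 or
a repaired Margin232 until a kernel theorem says so.»
-/

noncomputable section

namespace Summit.Parity.GeneralizedHardyLittlewood.Theorems.BeyondDiagonalBeatsQuarter.OffDiag

open Finset
open Literature.NumberTheory.Sieve

/-! ### One-modulus tools for the assembly: linearity in the level weight and the trivial bound -/

section OneModulusTools

variable (Q : Finset ℕ) {n : ℕ} (R : ℕ) (a : ZMod n)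

/-- `levelLargePart` is additive in the level weight. [folklore] -/
theorem levelLargePart_add (F G : ℕ → ℂ) :
    levelLargePart R Q (fun q ↦ F q + G q) n a = levelLargePart R Q F n a + levelLargePart R Q G n a := by
  unfold levelLargePart
  rw [← mul_add, ← Finset.sum_add_distrib]
  congr 1
  refine Finset.sum_congr rfl fun χ _ ↦ ?_
  rw [← mul_add, ← Finset.sum_add_distrib]
  congr 1
  exact Finset.sum_congr rfl fun q _ ↦ by ring

/-- `levelLargePart` is homogeneous in the level weight: a `q`-independent factor comes out. [folklore] -/
theorem levelLargePart_const_mul (g : ℂ) (F : ℕ → ℂ) :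
    levelLargePart R Q (fun q ↦ g * F q) n a = g * levelLargePart R Q F n a := by
  unfold levelLargePart
  have h1 : ∀ χ : DirichletCharacter ℂ n, ∑ q ∈ Q, g * F q * χ q = g * ∑ q ∈ Q, F q * χ q := fun χ ↦ by
    rw [Finset.mul_sum]
    exact Finset.sum_congr rfl fun q _ ↦ by ring
  have h2 : ∀ χ : DirichletCharacter ℂ n,
      χ a⁻¹ * (g * ∑ q ∈ Q, F q * χ q) = g * (χ a⁻¹ * ∑ q ∈ Q, F q * χ q) := fun χ ↦ by ring
  simp_rw [h1, h2, ← Finset.mul_sum]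
  ring

/-- `levelLargePart` of a finite sum of level weights (SEPARATED weights `F(q) = Σ_j g_j·b_j(q)` are consumed term by
term: the form L7c delivers). [folklore] -/
theorem levelLargePart_fun_sum {κ : Type*} (J : Finset κ) (G : κ → ℕ → ℂ) :
    levelLargePart R Q (fun q ↦ ∑ j ∈ J, G j q) n a = ∑ j ∈ J, levelLargePart R Q (G j) n a := by
  classical
  induction J using Finset.induction_on with
  | empty =>
    simp only [Finset.sum_empty]
    simp [levelLargePart]
  | insert j J hj ih =>
    simp only [Finset.sum_insert hj]
    rw [← ih, ← levelLargePart_add]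

/-- A character sum of the level weight is trivially at most `Σ_{q∈Q} ‖F q‖`. [folklore] -/
theorem norm_sum_mul_char_le (F : ℕ → ℂ) (χ : DirichletCharacter ℂ n) :
    ‖∑ q ∈ Q, F q * χ q‖ ≤ ∑ q ∈ Q, ‖F q‖ := by
  refine (norm_sum_le _ _).trans (Finset.sum_le_sum fun q _ ↦ ?_)
  rw [norm_mul]
  exact mul_le_of_le_one_right (norm_nonneg _) (DirichletCharacter.norm_le_one χ _)

variable [NeZero n]

/-- There are `φ(n)` Dirichlet characters mod `n ≥ 1` with complex values. [folklore] -/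
theorem card_dirichletCharacter_eq_totient : Fintype.card (DirichletCharacter ℂ n) = n.totient := by
  rw [← Nat.card_eq_fintype_card]
  exact DirichletCharacter.card_eq_totient_of_hasEnoughRootsOfUnity ℂ n

/-- **Trivial bound for a `φ⁻¹`-normalised character combination**: for any family `T` of characters mod `n ≥ 1`,
`‖φ(n)⁻¹ Σ_{χ ∈ T} χ(a⁻¹) Σ_Q F χ‖ ≤ Σ_{q∈Q} ‖F q‖` (`#T ≤ φ(n)`, `|χ| ≤ 1`). [folklore] -/
theorem norm_totientInv_mul_charComb_le (F : ℕ → ℂ) (T : Finset (DirichletCharacter ℂ n)) :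
    ‖((Nat.totient n : ℂ))⁻¹ * ∑ χ ∈ T, χ a⁻¹ * ∑ q ∈ Q, F q * χ q‖ ≤ ∑ q ∈ Q, ‖F q‖ := by
  have hφ0 : (0 : ℝ) < n.totient := by exact_mod_cast Nat.totient_pos.2 (NeZero.pos n)
  rw [norm_mul, norm_inv, Complex.norm_natCast]
  calc ((n.totient : ℝ))⁻¹ * ‖∑ χ ∈ T, χ a⁻¹ * ∑ q ∈ Q, F q * χ q‖
      ≤ ((n.totient : ℝ))⁻¹ * ∑ χ ∈ T, ‖χ a⁻¹ * ∑ q ∈ Q, F q * χ q‖ := by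
        gcongr
        exact norm_sum_le _ _
    _ ≤ ((n.totient : ℝ))⁻¹ * ∑ χ ∈ T, ∑ q ∈ Q, ‖F q‖ := by
        gcongr with χ _
        rw [norm_mul]
        calc ‖χ a⁻¹‖ * ‖∑ q ∈ Q, F q * χ q‖ ≤ 1 * ∑ q ∈ Q, ‖F q‖ :=
              mul_le_mul (DirichletCharacter.norm_le_one χ _) (norm_sum_mul_char_le Q F χ) (norm_nonneg _)
                zero_le_one
          _ = ∑ q ∈ Q, ‖F q‖ := one_mul _
    _ ≤ ((n.totient : ℝ))⁻¹ * ∑ _χ : DirichletCharacter ℂ n, ∑ q ∈ Q, ‖F q‖ := by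
        exact mul_le_mul_of_nonneg_left (Finset.sum_le_sum_of_subset_of_nonneg (Finset.subset_univ T)
          fun _ _ _ ↦ Finset.sum_nonneg fun q _ ↦ norm_nonneg (F q)) (inv_nonneg.2 hφ0.le)
    _ = ∑ q ∈ Q, ‖F q‖ := by
        rw [Finset.sum_const, Finset.card_univ, card_dirichletCharacter_eq_totient, nsmul_eq_mul, ← mul_assoc,
          inv_mul_cancel₀ hφ0.ne', one_mul]

/-- **Trivial bound for the large-conductor part**: `‖levelLargePart R Q F n a‖ ≤ Σ_{q∈Q} ‖F q‖` — the «trivial mass»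
of one (modulus, class) term, against which the large-sieve saving is measured. [folklore] -/
theorem norm_levelLargePart_le (F : ℕ → ℂ) : ‖levelLargePart R Q F n a‖ ≤ ∑ q ∈ Q, ‖F q‖ :=
  norm_totientInv_mul_charComb_le Q a F _

/-- **Trivial bound for the small-conductor part**: `‖levelSmallPart R Q F n a‖ ≤ Σ_{q∈Q} ‖F q‖`. [folklore] -/
theorem norm_levelSmallPart_le (F : ℕ → ℂ) : ‖levelSmallPart R Q F n a‖ ≤ ∑ q ∈ Q, ‖F q‖ :=
  norm_totientInv_mul_charComb_le Q a F _

end OneModulusTools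

/-! ### All moduli `h ≤ H`: the large-sieve bound for the large-conductor parts (E18) and its Cauchy–Schwarz forms -/

section AllModuli

variable (Q : Finset ℕ) (F : ℕ → ℂ) {M₀ N R H : ℕ}

/-- **Large sieve for the character sums of the level weight, all moduli** (E18 in `Q`-form): for levels
`Q ⊆ (M₀, M₀+N]` coprime to every modulus `1 ≤ h ≤ H` and `1 ≤ R`,
`Σ_{h ≤ H} φ(h)⁻¹ Σ_{χ mod h, cond χ > R} ‖Σ_{q∈Q} F q χ q‖² ≤ (1 + log H)²·(2(N+1)/R + 4H)·Σ_{q∈Q} ‖F q‖²`.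
[cite: Davenport1980, ch. 29 — derivation; IwaniecKowalski2004, Thm 7.13 — derivation] -/
theorem sum_moduli_totient_inv_sum_largeConductor_le (hR : 1 ≤ R) (hQ : Q ⊆ Finset.Ioc M₀ (M₀ + N))
    (hcop : ∀ q ∈ Q, ∀ h ∈ Finset.Icc 1 H, Nat.Coprime q h) :
    ∑ h ∈ Finset.Icc 1 H, ((h.totient : ℝ))⁻¹ *
        ∑ χ : DirichletCharacter ℂ h with R < χ.conductor, ‖∑ q ∈ Q, F q * χ q‖ ^ 2 ≤
      (1 + Real.log H) ^ 2 * (2 * ((N : ℝ) + 1) / R + 4 * H) * ∑ q ∈ Q, ‖F q‖ ^ 2 := by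
  classical
  set a : ℕ → ℂ := fun m ↦ if m ∈ Q then F m else 0 with ha
  have hS : ∀ (h : ℕ) (χ : DirichletCharacter ℂ h),
      ∑ m ∈ Finset.Ioc M₀ (M₀ + N), a m * χ m = ∑ q ∈ Q, F q * χ q := by
    intro h χ
    simp only [ha, ite_mul, zero_mul, Finset.sum_ite_mem, Finset.inter_eq_right.2 hQ]
  have ha2 : ∑ m ∈ Finset.Ioc M₀ (M₀ + N), ‖a m‖ ^ 2 = ∑ q ∈ Q, ‖F q‖ ^ 2 := by
    have : ∀ m, ‖a m‖ ^ 2 = if m ∈ Q then ‖F m‖ ^ 2 else 0 := by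
      intro m; simp only [ha]; split_ifs <;> simp
    simp only [this, Finset.sum_ite_mem, Finset.inter_eq_right.2 hQ]
  have hcop' : ∀ m ∈ Finset.Ioc M₀ (M₀ + N), a m ≠ 0 → ∀ h ∈ Finset.Icc 1 H, m.Coprime h := by
    intro m _ hm h hh
    have hmQ : m ∈ Q := by
      by_contra hmQ
      exact hm (by simp only [ha, if_neg hmQ])
    exact hcop m hmQ h hh
  have key := LargeSieve.sum_totient_inv_largeConductor_le' a M₀ N R H hR hcop'
  simp_rw [hS, ha2] at key
  exact key

/-- **Mean square of the large-conductor parts over all moduli and classes** (classes by representatives):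
`Σ_{1 ≤ h ≤ H} Σ_{c < h, (c,h)=1} ‖levelLargePart R Q F h c‖² ≤ (1 + log H)²·(2(N+1)/R + 4H)·Σ_{q∈Q} ‖F q‖²`
for `Q ⊆ (M₀, M₀+N]` coprime to all moduli `≤ H`, `1 ≤ R`. [cite: Davenport1980, ch. 29 — derivation] -/
theorem sum_moduli_sum_coprime_norm_sq_levelLargePart_le (hR : 1 ≤ R) (hQ : Q ⊆ Finset.Ioc M₀ (M₀ + N))
    (hcop : ∀ q ∈ Q, ∀ h ∈ Finset.Icc 1 H, Nat.Coprime q h) :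
    ∑ h ∈ Finset.Icc 1 H, ∑ c ∈ (Finset.range h).filter (fun c ↦ c.Coprime h),
        ‖levelLargePart R Q F h (c : ZMod h)‖ ^ 2 ≤
      (1 + Real.log H) ^ 2 * (2 * ((N : ℝ) + 1) / R + 4 * H) * ∑ q ∈ Q, ‖F q‖ ^ 2 := by
  refine le_trans (le_of_eq (Finset.sum_congr rfl fun h hh ↦ ?_))
    (sum_moduli_totient_inv_sum_largeConductor_le Q F hR hQ hcop)
  haveI : NeZero h := ⟨by have := (Finset.mem_Icc.1 hh).1; omega⟩
  exact sum_range_coprime_norm_sq_levelLargePart Q F R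

/-- The square root of the large-sieve constant: `((1 + log H)²·A·S)^{1/2} = (1 + log H)·A^{1/2}·S^{1/2}` for the
nonnegative `A = 2(N+1)/R + 4H`. [folklore] -/
theorem sqrt_largeSieveConst_mul (S : ℝ) :
    Real.sqrt ((1 + Real.log H) ^ 2 * (2 * ((N : ℝ) + 1) / R + 4 * H) * S) =
      (1 + Real.log H) * Real.sqrt (2 * ((N : ℝ) + 1) / R + 4 * H) * Real.sqrt S := by
  have hlog : 0 ≤ 1 + Real.log H := by have := Real.log_natCast_nonneg H; linarith
  rw [Real.sqrt_mul (by positivity), Real.sqrt_mul (sq_nonneg _), Real.sqrt_sq hlog]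

/-- **Weighted Cauchy–Schwarz form of the large-sieve bound** (the shape a dispersion-free user needs): for any
weights `W(h,c)` on the (modulus, reduced class) pairs,
`‖Σ_{1 ≤ h ≤ H} Σ_{c < h, (c,h)=1} W(h,c)·levelLargePart R Q F h c‖ ≤ ‖W‖₂·(1 + log H)·(2(N+1)/R + 4H)^{1/2}·‖F‖₂`
(`Q ⊆ (M₀, M₀+N]` coprime to all moduli `≤ H`, `1 ≤ R`). [cite: Davenport1980, ch. 29 — derivation;
IwaniecKowalski2004, §17.3 — derivation] -/
theorem norm_sum_moduli_sum_coprime_mul_levelLargePart_le (hR : 1 ≤ R) (hQ : Q ⊆ Finset.Ioc M₀ (M₀ + N))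
    (hcop : ∀ q ∈ Q, ∀ h ∈ Finset.Icc 1 H, Nat.Coprime q h) (W : ℕ → ℕ → ℂ) :
    ‖∑ h ∈ Finset.Icc 1 H, ∑ c ∈ (Finset.range h).filter (fun c ↦ c.Coprime h),
        W h c * levelLargePart R Q F h (c : ZMod h)‖ ≤
      Real.sqrt (∑ h ∈ Finset.Icc 1 H, ∑ c ∈ (Finset.range h).filter (fun c ↦ c.Coprime h), ‖W h c‖ ^ 2) *
        ((1 + Real.log H) * Real.sqrt (2 * ((N : ℝ) + 1) / R + 4 * H) * Real.sqrt (∑ q ∈ Q, ‖F q‖ ^ 2)) := by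
  -- triangle inequality
  have h1 : ‖∑ h ∈ Finset.Icc 1 H, ∑ c ∈ (Finset.range h).filter (fun c ↦ c.Coprime h),
        W h c * levelLargePart R Q F h (c : ZMod h)‖ ≤
      ∑ h ∈ Finset.Icc 1 H, ∑ c ∈ (Finset.range h).filter (fun c ↦ c.Coprime h),
        ‖W h c‖ * ‖levelLargePart R Q F h (c : ZMod h)‖ := by
    refine (norm_sum_le _ _).trans (Finset.sum_le_sum fun h _ ↦ (norm_sum_le _ _).trans (le_of_eq ?_))
    exact Finset.sum_congr rfl fun c _ ↦ norm_mul _ _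
  -- Cauchy–Schwarz on the flattened (modulus, class) index
  have h2 : ∑ h ∈ Finset.Icc 1 H, ∑ c ∈ (Finset.range h).filter (fun c ↦ c.Coprime h),
        ‖W h c‖ * ‖levelLargePart R Q F h (c : ZMod h)‖ ≤
      Real.sqrt (∑ h ∈ Finset.Icc 1 H, ∑ c ∈ (Finset.range h).filter (fun c ↦ c.Coprime h), ‖W h c‖ ^ 2) *
        Real.sqrt (∑ h ∈ Finset.Icc 1 H, ∑ c ∈ (Finset.range h).filter (fun c ↦ c.Coprime h),
          ‖levelLargePart R Q F h (c : ZMod h)‖ ^ 2) := by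
    rw [Finset.sum_sigma' (Finset.Icc 1 H) (fun h ↦ (Finset.range h).filter (fun c ↦ c.Coprime h))
        (fun h c ↦ ‖W h c‖ * ‖levelLargePart R Q F h (c : ZMod h)‖),
      Finset.sum_sigma' (Finset.Icc 1 H) (fun h ↦ (Finset.range h).filter (fun c ↦ c.Coprime h))
        (fun h c ↦ ‖W h c‖ ^ 2),
      Finset.sum_sigma' (Finset.Icc 1 H) (fun h ↦ (Finset.range h).filter (fun c ↦ c.Coprime h))
        (fun h c ↦ ‖levelLargePart R Q F h (c : ZMod h)‖ ^ 2)]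
    exact Real.sum_mul_le_sqrt_mul_sqrt _ _ _
  -- the large sieve for the second factor
  have h3 : Real.sqrt (∑ h ∈ Finset.Icc 1 H, ∑ c ∈ (Finset.range h).filter (fun c ↦ c.Coprime h),
          ‖levelLargePart R Q F h (c : ZMod h)‖ ^ 2) ≤
      (1 + Real.log H) * Real.sqrt (2 * ((N : ℝ) + 1) / R + 4 * H) * Real.sqrt (∑ q ∈ Q, ‖F q‖ ^ 2) := by
    rw [← sqrt_largeSieveConst_mul]
    exact Real.sqrt_le_sqrt (sum_moduli_sum_coprime_norm_sq_levelLargePart_le Q F hR hQ hcop)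
  exact h1.trans (h2.trans (mul_le_mul_of_nonneg_left h3 (Real.sqrt_nonneg _)))

/-- **Fibre Cauchy–Schwarz**: grouping a weighted family by a key, `Σ_k ‖Σ_{i : key i = k} w_i‖² ≤ Σ_i #(fibre of i)·‖w_i‖²`,
in the form with a bound `m(k) ≥ #fibre(k)`: `Σ_{k ∈ t} ‖Σ_{i ∈ s, key i = k} w_i‖² ≤ Σ_{i ∈ s} m(key i)·‖w_i‖²` when `key`
maps `s` into `t`. [folklore] -/
theorem sum_norm_sq_sum_fiber_le {ι κ : Type*} [DecidableEq κ] (s : Finset ι) (t : Finset κ) (key : ι → κ)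
    (hkey : ∀ i ∈ s, key i ∈ t) (w : ι → ℂ) (m : κ → ℝ)
    (hm : ∀ k ∈ t, ((s.filter (fun i ↦ key i = k)).card : ℝ) ≤ m k) :
    ∑ k ∈ t, ‖∑ i ∈ s.filter (fun i ↦ key i = k), w i‖ ^ 2 ≤ ∑ i ∈ s, m (key i) * ‖w i‖ ^ 2 := by
  rw [← Finset.sum_fiberwise_of_maps_to hkey (fun i ↦ m (key i) * ‖w i‖ ^ 2)]
  refine Finset.sum_le_sum fun k hk ↦ ?_
  calc ‖∑ i ∈ s.filter (fun i ↦ key i = k), w i‖ ^ 2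
      ≤ (∑ i ∈ s.filter (fun i ↦ key i = k), ‖w i‖) ^ 2 := by
        gcongr
        exact norm_sum_le _ _
    _ ≤ ((s.filter (fun i ↦ key i = k)).card : ℝ) * ∑ i ∈ s.filter (fun i ↦ key i = k), ‖w i‖ ^ 2 :=
        sq_sum_le_card_mul_sum_sq
    _ ≤ m k * ∑ i ∈ s.filter (fun i ↦ key i = k), ‖w i‖ ^ 2 :=
        mul_le_mul_of_nonneg_right (hm k hk) (Finset.sum_nonneg fun _ _ ↦ sq_nonneg _)
    _ = ∑ i ∈ s.filter (fun i ↦ key i = k), m (key i) * ‖w i‖ ^ 2 := by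
        rw [Finset.mul_sum]
        exact Finset.sum_congr rfl fun i hi ↦ by rw [(Finset.mem_filter.1 hi).2]

/-- **Index form of the large-sieve bound with a multiplicity (flatness) count.** A finite family `i ∈ I` of
(modulus, class-representative) pairs `(md i, cl i)` with `1 ≤ md i ≤ H`, `cl i < md i`, `(cl i, md i) = 1`, weights `w i`,
and a bound `m(h)` for the number of indices hitting any one class of the modulus `h`:
`‖Σ_{i∈I} w_i·levelLargePart R Q F (md i) (cl i)‖ ≤ (Σ_{i∈I} m(md i)‖w_i‖²)^{1/2}·(1 + log H)(2(N+1)/R + 4H)^{1/2}‖F‖₂`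
(`Q ⊆ (M₀, M₀+N]` coprime to all moduli `≤ H`, `1 ≤ R`). With the flatness count `m(h) ≍ M²/h + M` of the classes
`−lm(cs)⁻¹` (L7b) this is the a8R bound of OMEGA-BLUEPRINT v4 §3c before the ms-currency bookkeeping (L7d).
[cite: Davenport1980, ch. 29 — derivation; IwaniecKowalski2004, §17.3 — derivation] -/
theorem norm_sum_mul_levelLargePart_le_of_multiplicity (hR : 1 ≤ R) (hQ : Q ⊆ Finset.Ioc M₀ (M₀ + N))
    (hcop : ∀ q ∈ Q, ∀ h ∈ Finset.Icc 1 H, Nat.Coprime q h) {ι : Type*} (I : Finset ι) (md cl : ι → ℕ)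
    (w : ι → ℂ) (hI : ∀ i ∈ I, md i ∈ Finset.Icc 1 H ∧ cl i < md i ∧ (cl i).Coprime (md i)) (m : ℕ → ℝ)
    (hm : ∀ h ∈ Finset.Icc 1 H, ∀ c : ℕ, ((I.filter (fun i ↦ md i = h ∧ cl i = c)).card : ℝ) ≤ m h) :
    ‖∑ i ∈ I, w i * levelLargePart R Q F (md i) (cl i : ZMod (md i))‖ ≤
      Real.sqrt (∑ i ∈ I, m (md i) * ‖w i‖ ^ 2) *
        ((1 + Real.log H) * Real.sqrt (2 * ((N : ℝ) + 1) / R + 4 * H) * Real.sqrt (∑ q ∈ Q, ‖F q‖ ^ 2)) := by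
  classical
  -- the key `i ↦ ⟨md i, cl i⟩` maps `I` into the (modulus, class) index
  set t : Finset (Σ _ : ℕ, ℕ) :=
    (Finset.Icc 1 H).sigma (fun h ↦ (Finset.range h).filter (fun c ↦ c.Coprime h)) with ht
  set key : ι → (Σ _ : ℕ, ℕ) := fun i ↦ ⟨md i, cl i⟩ with hkeydef
  have hkey : ∀ i ∈ I, key i ∈ t := by
    intro i hi
    obtain ⟨h1, h2, h3⟩ := hI i hi
    rw [ht, Finset.mem_sigma]
    exact ⟨h1, Finset.mem_filter.2 ⟨Finset.mem_range.2 h2, h3⟩⟩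
  -- grouped weights
  set W : ℕ → ℕ → ℂ := fun h c ↦ ∑ i ∈ I.filter (fun i ↦ key i = ⟨h, c⟩), w i with hW
  -- regroup the sum by fibres of `key`
  have hregroup : ∑ i ∈ I, w i * levelLargePart R Q F (md i) (cl i : ZMod (md i)) =
      ∑ h ∈ Finset.Icc 1 H, ∑ c ∈ (Finset.range h).filter (fun c ↦ c.Coprime h),
        W h c * levelLargePart R Q F h (c : ZMod h) := by
    rw [← Finset.sum_fiberwise_of_maps_to hkey (fun i ↦ w i * levelLargePart R Q F (md i) (cl i : ZMod (md i))),
      ht, Finset.sum_sigma]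
    refine Finset.sum_congr rfl fun h _ ↦ Finset.sum_congr rfl fun c _ ↦ ?_
    rw [hW, Finset.sum_mul]
    refine Finset.sum_congr rfl fun i hi ↦ ?_
    have hk : key i = ⟨h, c⟩ := (Finset.mem_filter.1 hi).2
    simp only [hkeydef, Sigma.mk.injEq] at hk
    obtain ⟨rfl, hk2⟩ := hk
    rw [eq_of_heq hk2]
  -- the grouped ℓ²-norm is controlled by the multiplicity
  have hW2 : ∑ h ∈ Finset.Icc 1 H, ∑ c ∈ (Finset.range h).filter (fun c ↦ c.Coprime h), ‖W h c‖ ^ 2 ≤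
      ∑ i ∈ I, m (md i) * ‖w i‖ ^ 2 := by
    rw [Finset.sum_sigma' (Finset.Icc 1 H) (fun h ↦ (Finset.range h).filter (fun c ↦ c.Coprime h))
        (fun h c ↦ ‖W h c‖ ^ 2)]
    have := sum_norm_sq_sum_fiber_le I t key hkey w (fun k ↦ m k.1) (fun k hk ↦ ?_)
    · simpa only [hW, hkeydef] using this
    · obtain ⟨h, c⟩ := k
      have hh : h ∈ Finset.Icc 1 H := (Finset.mem_sigma.1 (by rw [ht] at hk; exact hk)).1
      refine le_trans (le_of_eq ?_) (hm h hh c)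
      congr 2
      refine Finset.filter_congr fun i _ ↦ ?_
      simp only [hkeydef, Sigma.mk.injEq, heq_eq_eq]
  rw [hregroup]
  refine (norm_sum_moduli_sum_coprime_mul_levelLargePart_le Q F hR hQ hcop W).trans ?_
  exact mul_le_mul_of_nonneg_right (Real.sqrt_le_sqrt hW2) (by positivity)

/-- **Index form with classes given as units of `ZMod (md i)`** (the shape the divisor switch produces: class
`−ab·(cs)⁻¹ mod |h₁|`): as `norm_sum_mul_levelLargePart_le_of_multiplicity`, with the multiplicity counted on the
representatives `(a i).val`. [cite: Davenport1980, ch. 29 — derivation; IwaniecKowalski2004, §17.3 — derivation] -/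
theorem norm_sum_mul_levelLargePart_le_of_multiplicity_zmod (hR : 1 ≤ R) (hQ : Q ⊆ Finset.Ioc M₀ (M₀ + N))
    (hcop : ∀ q ∈ Q, ∀ h ∈ Finset.Icc 1 H, Nat.Coprime q h) {ι : Type*} (I : Finset ι) (md : ι → ℕ)
    (a : (i : ι) → ZMod (md i)) (w : ι → ℂ) (hI : ∀ i ∈ I, md i ∈ Finset.Icc 1 H ∧ IsUnit (a i)) (m : ℕ → ℝ)
    (hm : ∀ h ∈ Finset.Icc 1 H, ∀ c : ℕ, ((I.filter (fun i ↦ md i = h ∧ (a i).val = c)).card : ℝ) ≤ m h) :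
    ‖∑ i ∈ I, w i * levelLargePart R Q F (md i) (a i)‖ ≤
      Real.sqrt (∑ i ∈ I, m (md i) * ‖w i‖ ^ 2) *
        ((1 + Real.log H) * Real.sqrt (2 * ((N : ℝ) + 1) / R + 4 * H) * Real.sqrt (∑ q ∈ Q, ‖F q‖ ^ 2)) := by
  have hval : ∀ i ∈ I, ((a i).val : ZMod (md i)) = a i := by
    intro i hi
    haveI : NeZero (md i) := ⟨by have := (Finset.mem_Icc.1 (hI i hi).1).1; omega⟩
    exact ZMod.natCast_zmod_val (a i)
  rw [Finset.sum_congr rfl fun i hi ↦ by rw [← hval i hi]]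
  refine norm_sum_mul_levelLargePart_le_of_multiplicity Q F hR hQ hcop I md (fun i ↦ (a i).val) w
    (fun i hi ↦ ⟨(hI i hi).1, ?_, ?_⟩) m hm
  · haveI : NeZero (md i) := ⟨by have := (Finset.mem_Icc.1 (hI i hi).1).1; omega⟩
    exact ZMod.val_lt _
  · obtain ⟨u, hu⟩ := (hI i hi).2
    rw [← hu]
    exact ZMod.val_coe_unit_coprime u

/-! ### The prime-level specialisation: `Q ⊆` primes of `(N₀, 2N₀]`, moduli `≤ H ≤ N₀` -/

/-- A prime `q > H ≥ h ≥ 1` is coprime to `h`. [folklore] -/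
theorem coprime_of_prime_of_lt {q h : ℕ} (hq : q.Prime) (h1 : 1 ≤ h) (hlt : h < q) : Nat.Coprime q h :=
  (Nat.Prime.coprime_iff_not_dvd hq).2 (Nat.not_dvd_of_pos_of_lt h1 hlt)

/-- For `Q ⊆` the primes of `(N₀, 2N₀]` and moduli `h ≤ H ≤ N₀`: every level is coprime to every modulus, and
`Q ⊆ (N₀, N₀ + N₀]`. [folklore] -/
theorem coprime_moduli_of_subset_primes {N₀ : ℕ} (hQ : Q ⊆ (Finset.Ioc N₀ (2 * N₀)).filter Nat.Prime)
    (hH : H ≤ N₀) : (Q ⊆ Finset.Ioc N₀ (N₀ + N₀)) ∧ ∀ q ∈ Q, ∀ h ∈ Finset.Icc 1 H, Nat.Coprime q h := by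
  refine ⟨fun q hq ↦ by rw [← two_mul]; exact (Finset.mem_filter.1 (hQ hq)).1, fun q hq h hh ↦ ?_⟩
  obtain ⟨hq1, hq2⟩ := Finset.mem_filter.1 (hQ hq)
  obtain ⟨hh1, hh2⟩ := Finset.mem_Icc.1 hh
  exact coprime_of_prime_of_lt hq2 hh1 (by have := (Finset.mem_Ioc.1 hq1).1; omega)

/-- **Prime levels, weighted form**: for `Q ⊆` the primes of `(N₀, 2N₀]` (e.g. `goodPrimes Δ′ N₀`), moduli `≤ H ≤ N₀`, `1 ≤ R`
and any weights `W(h,c)`: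
`‖Σ_{h ≤ H} Σ_{c reduced} W(h,c)·levelLargePart R Q F h c‖ ≤ ‖W‖₂·(1 + log H)·(2(N₀+1)/R + 4H)^{1/2}·‖F‖₂`.
[cite: Davenport1980, ch. 29 — derivation; IwaniecKowalski2004, §17.3 — derivation] -/
theorem norm_sum_moduli_sum_coprime_mul_levelLargePart_le_of_subset_primes {N₀ : ℕ} (hR : 1 ≤ R)
    (hQ : Q ⊆ (Finset.Ioc N₀ (2 * N₀)).filter Nat.Prime) (hH : H ≤ N₀) (W : ℕ → ℕ → ℂ) :
    ‖∑ h ∈ Finset.Icc 1 H, ∑ c ∈ (Finset.range h).filter (fun c ↦ c.Coprime h),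
        W h c * levelLargePart R Q F h (c : ZMod h)‖ ≤
      Real.sqrt (∑ h ∈ Finset.Icc 1 H, ∑ c ∈ (Finset.range h).filter (fun c ↦ c.Coprime h), ‖W h c‖ ^ 2) *
        ((1 + Real.log H) * Real.sqrt (2 * ((N₀ : ℝ) + 1) / R + 4 * H) * Real.sqrt (∑ q ∈ Q, ‖F q‖ ^ 2)) :=
  norm_sum_moduli_sum_coprime_mul_levelLargePart_le Q F hR (coprime_moduli_of_subset_primes Q hQ hH).1
    (coprime_moduli_of_subset_primes Q hQ hH).2 W

/-- **Prime levels, index form with multiplicity**: for `Q ⊆` the primes of `(N₀, 2N₀]`, moduli `≤ H ≤ N₀`, `1 ≤ R`, a finite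
family of (modulus, class) pairs with weights `w` and flatness bound `m`:
`‖Σ_i w_i·levelLargePart R Q F (md i) (cl i)‖ ≤ (Σ_i m(md i)‖w_i‖²)^{1/2}·(1 + log H)(2(N₀+1)/R + 4H)^{1/2}‖F‖₂`.
[cite: Davenport1980, ch. 29 — derivation; IwaniecKowalski2004, §17.3 — derivation] -/
theorem norm_sum_mul_levelLargePart_le_of_multiplicity_of_subset_primes {N₀ : ℕ} (hR : 1 ≤ R)
    (hQ : Q ⊆ (Finset.Ioc N₀ (2 * N₀)).filter Nat.Prime) (hH : H ≤ N₀) {ι : Type*} (I : Finset ι)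
    (md cl : ι → ℕ) (w : ι → ℂ) (hI : ∀ i ∈ I, md i ∈ Finset.Icc 1 H ∧ cl i < md i ∧ (cl i).Coprime (md i))
    (m : ℕ → ℝ) (hm : ∀ h ∈ Finset.Icc 1 H, ∀ c : ℕ, ((I.filter (fun i ↦ md i = h ∧ cl i = c)).card : ℝ) ≤ m h) :
    ‖∑ i ∈ I, w i * levelLargePart R Q F (md i) (cl i : ZMod (md i))‖ ≤
      Real.sqrt (∑ i ∈ I, m (md i) * ‖w i‖ ^ 2) *
        ((1 + Real.log H) * Real.sqrt (2 * ((N₀ : ℝ) + 1) / R + 4 * H) * Real.sqrt (∑ q ∈ Q, ‖F q‖ ^ 2)) :=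
  norm_sum_mul_levelLargePart_le_of_multiplicity Q F hR (coprime_moduli_of_subset_primes Q hQ hH).1
    (coprime_moduli_of_subset_primes Q hQ hH).2 I md cl w hI m hm

end AllModuli

end Summit.Parity.GeneralizedHardyLittlewood.Theorems.BeyondDiagonalBeatsQuarter.OffDiag
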